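import Summits.QuantumFields.YangMills.Theorems.CovariantDischargeCombSweepLinCobdLocal
import Summits.QuantumFields.YangMills.Theorems.CovariantDischargePlaqPairSum
import Literature.MathematicalPhysics.QuantumFieldTheory.Balaban1983to89.B10StarCount
import HarnessLib

/-!
# Line «sandwich_discharge» on crux `HistoryTailL` (stmt-QuantumFields-19936), stub `stub_sandwichSweepGapCapped` — GLUE-COST:
# THE COST ROWS OF THE COMB SWEEP IN CLOSED FORM (the algebraic half of the door's leaf `hGLUE`)

Cell `ym3-torus` (YM ladder rung R3 = continuum SU(2) Yang–Mills on the three-torus — a RUNG, NOT the Clay problem: not d = 4, not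
infinite volume, not a mass gap), width seat `ym-ust-19936-w5` gen 14, helper letters `--supports stmt-QuantumFields-19936`.

WHY.  The door skeleton of record (px8 g7, `DOOR-SKELETON-px8g7.lean` 664c2d33, 19936 evidence 13:20Z) has the leaf
`hGLUE : ∃ REST, REST ≤ s·θ∕16 + Bc·L^j·s² ∧ SIG − REST ≤ A(V) − A(Ψ′V)`, to be supplied by
✓`CovariantDischargeCombSweepLinCobdLocal.comb_pairing_sub_le_wilsonAction4_sub_sweepInv_local` (rows `Σ_q D_q·dist1 V(∂q)`,
`Σ_q r(t_q)·dist1 V(∂q)`, `½Σ_q (|s_q| + D_q + r(t_q))²`) plus cost bookkeeping plus the exponent rows.  This file does the bookkeeping ONCE, in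
closed form, for ANY signed amplitude `c : bonds → ℝ` with `|c_b| ≤ τ ≤ 1∕4` and `Σ_b |c_b| ≤ M₁`:
* §1 plaquette–bond incidence: `Σ_{q : Plaq} g(bondᵢ q) ≤ d·Σ_b g(b)` for `g ≥ 0`, `i = 1…4` (over lit ✓`B5Eq121HodgeIdentityVector.sum_plaq_eq`,
  ✓`B10StarCount.sum_pbond`, `shiftEquiv`);
* §2 one-variable letters: `r(t) = 6t²+4t³+t⁴ ≤ 11t²` on `[0,1]`, `(|a|+|b|+|c|+|d|)² ≤ 4(a²+b²+c²+d²)`, `(a+b+c)² ≤ 3(a²+b²+c²)`;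
* §3 ★★★ `rest_le`: with `s_q = c(b₁)+c(b₂)−c(b₃)−c(b₄)`, `D_q = 2Σᵢc(bᵢ)² + 2(|c(b₂)|η + |c(b₃)|·3η + |c(b₄)|θ)`, `t_q = Σᵢ|c(bᵢ)|`
  (passed with their defining equations, exactly as ✓`…LinCobdLocal` binds them), `PlaqSmall θ V`, `0 ≤ η`:
  `Σ_q D_q·dist1 V(∂q) + Σ_q r(t_q)·dist1 V(∂q) + ½Σ_q (|s_q| + D_q + r(t_q))²
     ≤ (3∕2)·Σ_q s_q² + θ·d·M₁·(2(4τ+4η+θ) + 176τ) + (3∕2)·d·M₁·((8τ²+2τ(4η+θ))·2(4τ+4η+θ) + 30976τ³)`;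
* §4 ★★★ `comb_signal_sub_cost_le_wilsonAction4_sub_mulField` ∕ ★★★ `…_sub_sweepInv` — composed with ✓`…LinCobdLocal`:
  `Σ_q (−s_q)·⟨n̂₀, imVec su2Quat W̃(∂q)⟩ − ⟨the closed form⟩ ≤ A(V) − A(Ψ′V)` (`Σ_q s_q² = ½Σ_xab (d₁c)²`: ✓`CovariantDischargePlaqPairSum.sum_curl_sq_eq_two_mul_sum_plaq`).
WHAT IT LEAVES for the knit: real arithmetic only — `τ := s·4A_T·L^{2j}` ((T″)), `M₁ := s·(A_L + A_L′(2R+1+2L^h))·4L^{2j}` ((S″)), `Σ_q s_q² ≤ (s²∕2)·(Q″)`.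
HONEST SCOPE: deterministic per-configuration algebra; nothing of the profile, the signal, the exponent rows, `stub_sandwichSweepGapCapped`,
`HistoryTailL` or any summit statement is proved or claimed. [cite: Balaban1985Averaging, (10) p.19, (19)-(20) p.21, p.24; Balaban1987RG1, (0.2) p.252]
-/

noncomputable section

open scoped BigOperators RealInnerProductSpace
open Literature.MathematicalPhysics.QuantumLattice (su2Quat)
open Literature.MathematicalPhysics.QuantumFieldTheory.Balaban1983to89
open Literature.MathematicalPhysics.QuantumFieldTheory.Balaban1983to89.T4CubeChartGnomonic (SU2)
open Literature.MathematicalPhysics.QuantumFieldTheory.Balaban1983to89.T4HaarSU2ExpChart (expPoint)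
open Literature.MathematicalPhysics.QuantumFieldTheory.Balaban1983to89.T4ExpWindowSmallField (imVec)
open Literature.MathematicalPhysics.QuantumFieldTheory.Balaban1983to89.T4WilsonLinkAffine (bond₁ bond₂ bond₃ bond₄)
open Literature.MathematicalPhysics.QuantumFieldTheory.Balaban1983to89.B15Prop1ChartSU2 (adSU2)
open Literature.MathematicalPhysics.QuantumFieldTheory.Balaban1983to89.B10Eq27TorusAxialLog (transl axialT)
open Literature.MathematicalPhysics.QuantumFieldTheory.Balaban1983to89.B5Eq121HodgeIdentityVector (sum_plaq_eq)
open Literature.MathematicalPhysics.QuantumFieldTheory.Balaban1983to89.B10StarCount (sum_pbond shiftEquiv)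
open Summit.QuantumFields.YangMills.Theorems.ApproxLift (mulField)
open Summit.QuantumFields.YangMills.Theorems.CovariantDischargeCombSweepLinCobdLocal
  (comb_pairing_sub_le_wilsonAction4_sub_mulField_local comb_pairing_sub_le_wilsonAction4_sub_sweepInv_local)

namespace Summit.QuantumFields.YangMills.Theorems.CovariantDischargeCombSweepCostRows

variable {P : Params} {k : ℕ}

/-! ## §1 Plaquette–bond incidence -/

/-- Dropping the orientation constraint: `Σ_{q : Plaq} f(x_q, μ_q, ν_q) ≤ Σ_x Σ_μ Σ_ν f(x, μ, ν)` for `f ≥ 0`. [folklore] -/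
theorem sum_plaq_le_sum_sum_sum (f : Site P k → Fin P.d → Fin P.d → ℝ) (hf : ∀ x a b, 0 ≤ f x a b) :
    ∑ q : Plaq P k, f q.src q.μ q.ν ≤ ∑ x : Site P k, ∑ a : Fin P.d, ∑ b : Fin P.d, f x a b := by
  rw [sum_plaq_eq]
  refine Finset.sum_le_sum fun x _ => Finset.sum_le_sum fun a _ => Finset.sum_le_sum fun b _ => ?_
  split_ifs
  · exact le_rfl
  · exact hf x a b

/-- `Σ_x Σ_μ Σ_ν g⟨x, μ⟩ = d·Σ_b g(b)`. [folklore] -/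
theorem sum_sum_sum_fst (g : PBond P k → ℝ) :
    ∑ x : Site P k, ∑ a : Fin P.d, ∑ _b : Fin P.d, g ⟨x, a⟩ = P.d * ∑ b : PBond P k, g b := by
  simp only [Finset.sum_const, Finset.card_univ, Fintype.card_fin, nsmul_eq_mul]
  rw [sum_pbond, Finset.mul_sum]
  refine Finset.sum_congr rfl fun x _ => ?_
  rw [Finset.mul_sum]

/-- `Σ_x Σ_μ Σ_ν g⟨x, ν⟩ = d·Σ_b g(b)`. [folklore] -/
theorem sum_sum_sum_snd (g : PBond P k → ℝ) :
    ∑ x : Site P k, ∑ _a : Fin P.d, ∑ b : Fin P.d, g ⟨x, b⟩ = P.d * ∑ b : PBond P k, g b := by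
  simp only [Finset.sum_const, Finset.card_univ, Fintype.card_fin, nsmul_eq_mul]
  rw [sum_pbond, Finset.mul_sum]

/-- `Σ_x Σ_μ Σ_ν g⟨x + e_μ, ν⟩ = d·Σ_b g(b)` (the shift is a bijection of sites). [folklore] -/
theorem sum_sum_sum_shift_fst (g : PBond P k → ℝ) :
    ∑ x : Site P k, ∑ a : Fin P.d, ∑ b : Fin P.d, g ⟨x.shift a, b⟩ = P.d * ∑ b : PBond P k, g b := by
  rw [Finset.sum_comm]
  have e : ∀ a : Fin P.d, ∑ x : Site P k, ∑ b : Fin P.d, g ⟨x.shift a, b⟩ = ∑ x : Site P k, ∑ b : Fin P.d, g ⟨x, b⟩ := fun a =>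
    Equiv.sum_comp (shiftEquiv a) (fun x => ∑ b : Fin P.d, g ⟨x, b⟩)
  simp only [e, Finset.sum_const, Finset.card_univ, Fintype.card_fin, nsmul_eq_mul]
  rw [sum_pbond]

/-- `Σ_x Σ_μ Σ_ν g⟨x + e_ν, μ⟩ = d·Σ_b g(b)`. [folklore] -/
theorem sum_sum_sum_shift_snd (g : PBond P k → ℝ) :
    ∑ x : Site P k, ∑ a : Fin P.d, ∑ b : Fin P.d, g ⟨x.shift b, a⟩ = P.d * ∑ b : PBond P k, g b := by
  have e : ∀ x : Site P k, ∑ a : Fin P.d, ∑ b : Fin P.d, g ⟨x.shift b, a⟩ = ∑ b : Fin P.d, ∑ a : Fin P.d, g ⟨x.shift b, a⟩ :=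
    fun x => Finset.sum_comm
  simp only [e]
  exact sum_sum_sum_shift_fst g

/-- ★ INCIDENCE, letter 1: `Σ_q g(b₁ q) ≤ d·Σ_b g(b)` for `g ≥ 0`. [folklore] -/
theorem sum_plaq_bond₁_le (g : PBond P k → ℝ) (hg : ∀ b, 0 ≤ g b) :
    ∑ q : Plaq P k, g (bond₁ q) ≤ P.d * ∑ b : PBond P k, g b := by
  have h := sum_plaq_le_sum_sum_sum (fun x a _ => g ⟨x, a⟩) (fun x a _ => hg _)
  rw [sum_sum_sum_fst] at h
  exact h

/-- ★ INCIDENCE, letter 2: `Σ_q g(b₂ q) ≤ d·Σ_b g(b)` for `g ≥ 0`. [folklore] -/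
theorem sum_plaq_bond₂_le (g : PBond P k → ℝ) (hg : ∀ b, 0 ≤ g b) :
    ∑ q : Plaq P k, g (bond₂ q) ≤ P.d * ∑ b : PBond P k, g b := by
  have h := sum_plaq_le_sum_sum_sum (fun x a b => g ⟨x.shift a, b⟩) (fun x a b => hg _)
  rw [sum_sum_sum_shift_fst] at h
  exact h

/-- ★ INCIDENCE, letter 3: `Σ_q g(b₃ q) ≤ d·Σ_b g(b)` for `g ≥ 0`. [folklore] -/
theorem sum_plaq_bond₃_le (g : PBond P k → ℝ) (hg : ∀ b, 0 ≤ g b) :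
    ∑ q : Plaq P k, g (bond₃ q) ≤ P.d * ∑ b : PBond P k, g b := by
  have h := sum_plaq_le_sum_sum_sum (fun x a b => g ⟨x.shift b, a⟩) (fun x a b => hg _)
  rw [sum_sum_sum_shift_snd] at h
  exact h

/-- ★ INCIDENCE, letter 4: `Σ_q g(b₄ q) ≤ d·Σ_b g(b)` for `g ≥ 0`. [folklore] -/
theorem sum_plaq_bond₄_le (g : PBond P k → ℝ) (hg : ∀ b, 0 ≤ g b) :
    ∑ q : Plaq P k, g (bond₄ q) ≤ P.d * ∑ b : PBond P k, g b := by
  have h := sum_plaq_le_sum_sum_sum (fun x _ b => g ⟨x, b⟩) (fun x _ b => hg _)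
  rw [sum_sum_sum_snd] at h
  exact h

/-! ## §2 One-variable letters -/

/-- `6t²+4t³+t⁴ ≤ 11t²` for `0 ≤ t ≤ 1` (≡ ✓`SymAvgPlaqAssembly.six_four_one_le_eleven_sq`, kept private to spare the import). [folklore] -/
private theorem r_le_eleven_sq {t : ℝ} (ht0 : 0 ≤ t) (ht1 : t ≤ 1) : 6 * t ^ 2 + 4 * t ^ 3 + t ^ 4 ≤ 11 * t ^ 2 := by
  have h3 : t ^ 3 ≤ t ^ 2 := by nlinarith [sq_nonneg t, mul_nonneg ht0 (sq_nonneg t)]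
  have h4 : t ^ 4 ≤ t ^ 2 := by nlinarith [sq_nonneg t, mul_nonneg ht0 (sq_nonneg t), pow_nonneg ht0 3]
  nlinarith

/-- `(|a|+|b|+|c|+|d|)² ≤ 4(a²+b²+c²+d²)`. [folklore] -/
theorem sq_sum_abs_four_le (a b c d : ℝ) : (|a| + |b| + |c| + |d|) ^ 2 ≤ 4 * (a ^ 2 + b ^ 2 + c ^ 2 + d ^ 2) := by
  rw [← sq_abs a, ← sq_abs b, ← sq_abs c, ← sq_abs d]
  nlinarith [sq_nonneg (|a| - |b|), sq_nonneg (|a| - |c|), sq_nonneg (|a| - |d|), sq_nonneg (|b| - |c|), sq_nonneg (|b| - |d|),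
    sq_nonneg (|c| - |d|)]

/-- `(a+b+c)² ≤ 3(a²+b²+c²)` (a landed one-liner elsewhere; private here). [folklore] -/
private theorem sq_add_three_le (a b c : ℝ) : (a + b + c) ^ 2 ≤ 3 * (a ^ 2 + b ^ 2 + c ^ 2) := by
  nlinarith [sq_nonneg (a - b), sq_nonneg (a - c), sq_nonneg (b - c)]

/-! ## §3 The cost rows in closed form -/

/-- Pointwise: the defect symbol `D = 2Σᵢcᵢ² + 2(|c₂|η + |c₃|·3η + |c₄|θ)` is `≥ 0` and `≤ 8τ² + 2τ(4η+θ)` when `|cᵢ| ≤ τ`. [folklore] -/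
theorem defect_bounds {η θ τ c₁ c₂ c₃ c₄ : ℝ} (hη : 0 ≤ η) (hθ : 0 ≤ θ) (h₁ : |c₁| ≤ τ) (h₂ : |c₂| ≤ τ)
    (h₃ : |c₃| ≤ τ) (h₄ : |c₄| ≤ τ) :
    0 ≤ 2 * (c₁ ^ 2 + c₂ ^ 2 + c₃ ^ 2 + c₄ ^ 2) + 2 * (|c₂| * η + |c₃| * (3 * η) + |c₄| * θ) ∧
    2 * (c₁ ^ 2 + c₂ ^ 2 + c₃ ^ 2 + c₄ ^ 2) + 2 * (|c₂| * η + |c₃| * (3 * η) + |c₄| * θ) ≤ 8 * τ ^ 2 + 2 * τ * (4 * η + θ) := by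
  have n₁ := abs_nonneg c₁; have n₂ := abs_nonneg c₂; have n₃ := abs_nonneg c₃; have n₄ := abs_nonneg c₄
  have s₁ : c₁ ^ 2 ≤ τ ^ 2 := by rw [← sq_abs]; exact pow_le_pow_left₀ n₁ h₁ 2
  have s₂ : c₂ ^ 2 ≤ τ ^ 2 := by rw [← sq_abs]; exact pow_le_pow_left₀ n₂ h₂ 2
  have s₃ : c₃ ^ 2 ≤ τ ^ 2 := by rw [← sq_abs]; exact pow_le_pow_left₀ n₃ h₃ 2
  have s₄ : c₄ ^ 2 ≤ τ ^ 2 := by rw [← sq_abs]; exact pow_le_pow_left₀ n₄ h₄ 2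
  have hη3 : (0 : ℝ) ≤ 3 * η := by positivity
  have m₂ := mul_le_mul_of_nonneg_right h₂ hη; have m₃ := mul_le_mul_of_nonneg_right h₃ hη3; have m₄ := mul_le_mul_of_nonneg_right h₄ hθ
  have p₂ := mul_nonneg n₂ hη; have p₃ := mul_nonneg n₃ hη3; have p₄ := mul_nonneg n₄ hθ; have q₁ := sq_nonneg c₁; have q₂ := sq_nonneg c₂; have q₃ := sq_nonneg c₃; have q₄ := sq_nonneg c₄
  constructor
  · linarith
  · have e : 8 * τ ^ 2 + 2 * τ * (4 * η + θ) = 2 * (τ ^ 2 + τ ^ 2 + τ ^ 2 + τ ^ 2) + 2 * (τ * η + τ * (3 * η) + τ * θ) := by ring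
    rw [e]
    linarith

/-- Pointwise: with `t = |c₁|+|c₂|+|c₃|+|c₄|`, `|cᵢ| ≤ τ ≤ 1∕4`: `0 ≤ r(t)`, `r(t) ≤ 44Σᵢcᵢ²`, `r(t)² ≤ 1936τ²·4Σᵢcᵢ²` (`r(t) = 6t²+4t³+t⁴`). [folklore] -/
theorem third_order_bounds {τ c₁ c₂ c₃ c₄ : ℝ} (hτ : τ ≤ 1 / 4) (h₁ : |c₁| ≤ τ) (h₂ : |c₂| ≤ τ) (h₃ : |c₃| ≤ τ)
    (h₄ : |c₄| ≤ τ) :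
    0 ≤ 6 * (|c₁| + |c₂| + |c₃| + |c₄|) ^ 2 + 4 * (|c₁| + |c₂| + |c₃| + |c₄|) ^ 3 + (|c₁| + |c₂| + |c₃| + |c₄|) ^ 4 ∧
    6 * (|c₁| + |c₂| + |c₃| + |c₄|) ^ 2 + 4 * (|c₁| + |c₂| + |c₃| + |c₄|) ^ 3 + (|c₁| + |c₂| + |c₃| + |c₄|) ^ 4 ≤
      44 * (c₁ ^ 2 + c₂ ^ 2 + c₃ ^ 2 + c₄ ^ 2) ∧
    (6 * (|c₁| + |c₂| + |c₃| + |c₄|) ^ 2 + 4 * (|c₁| + |c₂| + |c₃| + |c₄|) ^ 3 + (|c₁| + |c₂| + |c₃| + |c₄|) ^ 4) ^ 2 ≤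
      1936 * τ ^ 2 * (4 * (c₁ ^ 2 + c₂ ^ 2 + c₃ ^ 2 + c₄ ^ 2)) := by
  set t : ℝ := |c₁| + |c₂| + |c₃| + |c₄| with ht
  have h0 : 0 ≤ t := by rw [ht]; positivity
  have h4 : t ≤ 4 * τ := by rw [ht]; linarith
  have hsq4 : t ^ 2 ≤ 4 * (c₁ ^ 2 + c₂ ^ 2 + c₃ ^ 2 + c₄ ^ 2) := sq_sum_abs_four_le _ _ _ _
  have hr := r_le_eleven_sq h0 (by linarith)
  have hr0 : 0 ≤ 6 * t ^ 2 + 4 * t ^ 3 + t ^ 4 := by positivity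
  refine ⟨hr0, by linarith, ?_⟩
  have h5 : t ^ 2 ≤ (4 * τ) ^ 2 := pow_le_pow_left₀ h0 h4 2
  have h6 : (6 * t ^ 2 + 4 * t ^ 3 + t ^ 4) ^ 2 ≤ (11 * t ^ 2) ^ 2 := pow_le_pow_left₀ hr0 hr 2
  have h7 : (11 * t ^ 2) ^ 2 ≤ 1936 * τ ^ 2 * t ^ 2 := by
    have h8 := mul_le_mul_of_nonneg_right h5 (sq_nonneg t)
    have e : (11 * t ^ 2) ^ 2 = 121 * (t ^ 2 * t ^ 2) := by ring
    have e' : 1936 * τ ^ 2 * t ^ 2 = 121 * ((4 * τ) ^ 2 * t ^ 2) := by ring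
    rw [e, e']
    exact mul_le_mul_of_nonneg_left h8 (by norm_num)
  have h9 : 1936 * τ ^ 2 * t ^ 2 ≤ 1936 * τ ^ 2 * (4 * (c₁ ^ 2 + c₂ ^ 2 + c₃ ^ 2 + c₄ ^ 2)) :=
    mul_le_mul_of_nonneg_left hsq4 (by positivity)
  exact h6.trans (h7.trans h9)

/-- Pointwise: `(|a| + b + c)² ≤ 3(a² + b² + c²)`. [folklore] -/
theorem abs_sq_add_three_le (a b c : ℝ) : (|a| + b + c) ^ 2 ≤ 3 * (a ^ 2 + b ^ 2 + c ^ 2) := by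
  have h := sq_add_three_le (|a|) b c
  rwa [sq_abs] at h

/-- The four squared letters of every plaquette, summed: `Σ_q Σᵢ c(bᵢ q)² ≤ 4d·Σ_b c_b²`. [folklore] -/
theorem sum_four_sq_le (c : PBond P k → ℝ) {B : ℝ} (hsq : ∑ b : PBond P k, c b ^ 2 ≤ B) :
    ∑ q : Plaq P k, (c (bond₁ q) ^ 2 + c (bond₂ q) ^ 2 + c (bond₃ q) ^ 2 + c (bond₄ q) ^ 2) ≤ 4 * P.d * B := by
  have hd0 : (0 : ℝ) ≤ P.d := Nat.cast_nonneg _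
  have h₁ := sum_plaq_bond₁_le (fun b => c b ^ 2) (fun b => sq_nonneg _); have h₂ := sum_plaq_bond₂_le (fun b => c b ^ 2) (fun b => sq_nonneg _)
  have h₃ := sum_plaq_bond₃_le (fun b => c b ^ 2) (fun b => sq_nonneg _); have h₄ := sum_plaq_bond₄_le (fun b => c b ^ 2) (fun b => sq_nonneg _)
  rw [Finset.sum_add_distrib, Finset.sum_add_distrib, Finset.sum_add_distrib]
  have hm := mul_le_mul_of_nonneg_left hsq hd0
  linarith

/-- ROW MASS (i): `Σ_q D_q ≤ 2dM₁(4τ+4η+θ)` and `0 ≤ D_q ≤ 8τ² + 2τ(4η+θ)`. [folklore] -/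
theorem sum_defect_le {η θ : ℝ} (hη : 0 ≤ η) (hθ : 0 ≤ θ) (c : PBond P k → ℝ) {τ M₁ : ℝ} (hcτ : ∀ b, |c b| ≤ τ)
    (hτ0 : 0 ≤ τ) (hM : ∑ b : PBond P k, |c b| ≤ M₁) (D : Plaq P k → ℝ)
    (hD : ∀ q, D q = 2 * (c (bond₁ q) ^ 2 + c (bond₂ q) ^ 2 + c (bond₃ q) ^ 2 + c (bond₄ q) ^ 2) +
        2 * (|c (bond₂ q)| * η + |c (bond₃ q)| * (3 * η) + |c (bond₄ q)| * θ)) :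
    (∀ q, 0 ≤ D q ∧ D q ≤ 8 * τ ^ 2 + 2 * τ * (4 * η + θ)) ∧ ∑ q : Plaq P k, D q ≤ 2 * P.d * M₁ * (4 * τ + 4 * η + θ) := by
  have hd0 : (0 : ℝ) ≤ P.d := Nat.cast_nonneg _
  refine ⟨fun q => by rw [hD q]; exact defect_bounds hη hθ (hcτ _) (hcτ _) (hcτ _) (hcτ _), ?_⟩
  have hsq : ∑ b : PBond P k, c b ^ 2 ≤ τ * M₁ := by
    calc ∑ b : PBond P k, c b ^ 2 ≤ ∑ b : PBond P k, τ * |c b| := Finset.sum_le_sum fun b _ => by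
            rw [← sq_abs, sq]; exact mul_le_mul_of_nonneg_right (hcτ b) (abs_nonneg _)
      _ = τ * ∑ b : PBond P k, |c b| := (Finset.mul_sum _ _ _).symm
      _ ≤ τ * M₁ := mul_le_mul_of_nonneg_left hM hτ0
  have hA := sum_four_sq_le c hsq
  have hdM : (P.d : ℝ) * ∑ b : PBond P k, |c b| ≤ P.d * M₁ := mul_le_mul_of_nonneg_left hM hd0
  have hB₂ := (sum_plaq_bond₂_le (fun b => |c b|) (fun b => abs_nonneg _)).trans hdM; have hB₃ := (sum_plaq_bond₃_le (fun b => |c b|) (fun b => abs_nonneg _)).trans hdM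
  have hB₄ := (sum_plaq_bond₄_le (fun b => |c b|) (fun b => abs_nonneg _)).trans hdM
  have e : ∀ q, D q = 2 * (c (bond₁ q) ^ 2 + c (bond₂ q) ^ 2 + c (bond₃ q) ^ 2 + c (bond₄ q) ^ 2) +
      (2 * η) * |c (bond₂ q)| + (6 * η) * |c (bond₃ q)| + (2 * θ) * |c (bond₄ q)| := fun q => by rw [hD q]; ring
  rw [Finset.sum_congr rfl fun q (_ : q ∈ (Finset.univ : Finset (Plaq P k))) => e q, Finset.sum_add_distrib,
    Finset.sum_add_distrib, Finset.sum_add_distrib, ← Finset.mul_sum, ← Finset.mul_sum, ← Finset.mul_sum, ← Finset.mul_sum]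
  have m₁ := mul_le_mul_of_nonneg_left hA (by norm_num : (0 : ℝ) ≤ 2); have m₂ := mul_le_mul_of_nonneg_left hB₂ (by positivity : (0 : ℝ) ≤ 2 * η)
  have m₃ := mul_le_mul_of_nonneg_left hB₃ (by positivity : (0 : ℝ) ≤ 6 * η); have m₄ := mul_le_mul_of_nonneg_left hB₄ (by positivity : (0 : ℝ) ≤ 2 * θ)
  have ee : 2 * (4 * ↑P.d * (τ * M₁)) + 2 * η * (↑P.d * M₁) + 6 * η * (↑P.d * M₁) + 2 * θ * (↑P.d * M₁) =
      2 * ↑P.d * M₁ * (4 * τ + 4 * η + θ) := by ring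
  linarith

/-- ROW MASS (ii): with `t_q = Σᵢ|c(bᵢ q)|`: `0 ≤ r(t_q)`, `Σ_q r(t_q) ≤ 176dτM₁`, `Σ_q r(t_q)² ≤ 30976dτ³M₁`. [folklore] -/
theorem sum_third_order_le (c : PBond P k → ℝ) {τ M₁ : ℝ} (hcτ : ∀ b, |c b| ≤ τ) (hτ0 : 0 ≤ τ) (hτ : τ ≤ 1 / 4)
    (hM : ∑ b : PBond P k, |c b| ≤ M₁) (t : Plaq P k → ℝ)
    (hT : ∀ q, t q = |c (bond₁ q)| + |c (bond₂ q)| + |c (bond₃ q)| + |c (bond₄ q)|) :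
    (∀ q, 0 ≤ 6 * t q ^ 2 + 4 * t q ^ 3 + t q ^ 4) ∧
    ∑ q : Plaq P k, (6 * t q ^ 2 + 4 * t q ^ 3 + t q ^ 4) ≤ 176 * P.d * (τ * M₁) ∧
    ∑ q : Plaq P k, (6 * t q ^ 2 + 4 * t q ^ 3 + t q ^ 4) ^ 2 ≤ 1936 * τ ^ 2 * (4 * (4 * P.d * (τ * M₁))) := by
  have hpt : ∀ q, 0 ≤ 6 * t q ^ 2 + 4 * t q ^ 3 + t q ^ 4 ∧
      6 * t q ^ 2 + 4 * t q ^ 3 + t q ^ 4 ≤ 44 * (c (bond₁ q) ^ 2 + c (bond₂ q) ^ 2 + c (bond₃ q) ^ 2 + c (bond₄ q) ^ 2) ∧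
      (6 * t q ^ 2 + 4 * t q ^ 3 + t q ^ 4) ^ 2 ≤
        1936 * τ ^ 2 * (4 * (c (bond₁ q) ^ 2 + c (bond₂ q) ^ 2 + c (bond₃ q) ^ 2 + c (bond₄ q) ^ 2)) := fun q => by
    rw [hT q]; exact third_order_bounds hτ (hcτ _) (hcτ _) (hcτ _) (hcτ _)
  have hsq : ∑ b : PBond P k, c b ^ 2 ≤ τ * M₁ := by
    calc ∑ b : PBond P k, c b ^ 2 ≤ ∑ b : PBond P k, τ * |c b| := Finset.sum_le_sum fun b _ => by
            rw [← sq_abs, sq]; exact mul_le_mul_of_nonneg_right (hcτ b) (abs_nonneg _)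
      _ = τ * ∑ b : PBond P k, |c b| := (Finset.mul_sum _ _ _).symm
      _ ≤ τ * M₁ := mul_le_mul_of_nonneg_left hM hτ0
  have hA := sum_four_sq_le c hsq
  refine ⟨fun q => (hpt q).1, ?_, ?_⟩
  · calc ∑ q : Plaq P k, (6 * t q ^ 2 + 4 * t q ^ 3 + t q ^ 4)
        ≤ ∑ q : Plaq P k, 44 * (c (bond₁ q) ^ 2 + c (bond₂ q) ^ 2 + c (bond₃ q) ^ 2 + c (bond₄ q) ^ 2) :=
          Finset.sum_le_sum fun q _ => (hpt q).2.1
      _ = 44 * ∑ q : Plaq P k, (c (bond₁ q) ^ 2 + c (bond₂ q) ^ 2 + c (bond₃ q) ^ 2 + c (bond₄ q) ^ 2) :=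
          (Finset.mul_sum _ _ _).symm
      _ ≤ 44 * (4 * P.d * (τ * M₁)) := mul_le_mul_of_nonneg_left hA (by norm_num)
      _ = 176 * P.d * (τ * M₁) := by ring
  · calc ∑ q : Plaq P k, (6 * t q ^ 2 + 4 * t q ^ 3 + t q ^ 4) ^ 2
        ≤ ∑ q : Plaq P k, 1936 * τ ^ 2 * (4 * (c (bond₁ q) ^ 2 + c (bond₂ q) ^ 2 + c (bond₃ q) ^ 2 + c (bond₄ q) ^ 2)) :=
          Finset.sum_le_sum fun q _ => (hpt q).2.2
      _ = 1936 * τ ^ 2 * (4 * ∑ q : Plaq P k, (c (bond₁ q) ^ 2 + c (bond₂ q) ^ 2 + c (bond₃ q) ^ 2 + c (bond₄ q) ^ 2)) := by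
          rw [Finset.mul_sum, Finset.mul_sum]
      _ ≤ 1936 * τ ^ 2 * (4 * (4 * P.d * (τ * M₁))) :=
          mul_le_mul_of_nonneg_left (mul_le_mul_of_nonneg_left hA (by norm_num)) (by positivity)

/-- ★★★ **THE COST ROWS OF A FRAMED ONE-AXIS SWEEP, CLOSED FORM.**  For any amplitude `c : bonds → ℝ` with `|c_b| ≤ τ ≤ 1∕4` and
`Σ_b |c_b| ≤ M₁`, any `0 ≤ η`, any `V` with `PlaqSmall θ V`, ANY `s : Plaq → ℝ` (the signal coefficient is only squared), and the rows'
symbols `D_q = 2Σᵢc(bᵢ)² + 2(|c(b₂)|η + |c(b₃)|·3η + |c(b₄)|θ)`, `t_q = Σᵢ|c(bᵢ)|` (defining equations as ✓`…LinCobdLocal` binds them), `r(t) = 6t²+4t³+t⁴`: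
`Σ_q D_q·dist1 V(∂q) + Σ_q r(t_q)·dist1 V(∂q) + ½Σ_q (|s_q| + D_q + r(t_q))²`
`  ≤ (3∕2)Σ_q s_q² + θ·d·M₁·(2(4τ+4η+θ) + 176τ) + (3∕2)·d·M₁·((8τ²+2τ(4η+θ))·2(4τ+4η+θ) + 30976τ³)`
(incidence §1: each bond letter of a plaquette is hit `≤ d` times; `Σ_b c_b² ≤ τM₁`; `r(t_q) ≤ 11t_q² ≤ 44Σᵢc(bᵢ)²`, `t_q ≤ 4τ ≤ 1`).
[cite: Balaban1985Averaging, (10) p.19, (19)-(20) p.21, p.24] -/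
theorem rest_le {θ : ℝ} (hθ : 0 ≤ θ) {V : GaugeField P k SU2} (hV : PlaqSmall θ V) {η : ℝ} (hη : 0 ≤ η)
    (c : PBond P k → ℝ) {τ M₁ : ℝ} (hcτ : ∀ b, |c b| ≤ τ) (hτ0 : 0 ≤ τ) (hτ : τ ≤ 1 / 4) (hM : ∑ b : PBond P k, |c b| ≤ M₁)
    (s D t : Plaq P k → ℝ)
    (hD : ∀ q, D q = 2 * (c (bond₁ q) ^ 2 + c (bond₂ q) ^ 2 + c (bond₃ q) ^ 2 + c (bond₄ q) ^ 2) +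
        2 * (|c (bond₂ q)| * η + |c (bond₃ q)| * (3 * η) + |c (bond₄ q)| * θ))
    (hT : ∀ q, t q = |c (bond₁ q)| + |c (bond₂ q)| + |c (bond₃ q)| + |c (bond₄ q)|) :
    (∑ q : Plaq P k, D q * dist1 (GaugeField.plaqHol V q)) +
        (∑ q : Plaq P k, (6 * t q ^ 2 + 4 * t q ^ 3 + t q ^ 4) * dist1 (GaugeField.plaqHol V q)) +
        1 / 2 * ∑ q : Plaq P k, (|s q| + D q + (6 * t q ^ 2 + 4 * t q ^ 3 + t q ^ 4)) ^ 2 ≤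
      3 / 2 * ∑ q : Plaq P k, s q ^ 2 + θ * P.d * M₁ * (2 * (4 * τ + 4 * η + θ) + 176 * τ) +
        3 / 2 * P.d * M₁ * ((8 * τ ^ 2 + 2 * τ * (4 * η + θ)) * (2 * (4 * τ + 4 * η + θ)) + 30976 * τ ^ 3) := by
  obtain ⟨hDq, hSumD⟩ := sum_defect_le hη hθ c hcτ hτ0 hM D hD
  obtain ⟨hr0, hSumr, hSumr2⟩ := sum_third_order_le c hcτ hτ0 hτ hM t hT
  -- ROW (i)
  have row₁ : ∑ q : Plaq P k, D q * dist1 (GaugeField.plaqHol V q) ≤ θ * (2 * P.d * M₁ * (4 * τ + 4 * η + θ)) := by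
    calc ∑ q : Plaq P k, D q * dist1 (GaugeField.plaqHol V q) ≤ ∑ q : Plaq P k, D q * θ :=
          Finset.sum_le_sum fun q _ => mul_le_mul_of_nonneg_left (hV q).le (hDq q).1
      _ = θ * ∑ q : Plaq P k, D q := by rw [← Finset.sum_mul, mul_comm]
      _ ≤ θ * (2 * P.d * M₁ * (4 * τ + 4 * η + θ)) := mul_le_mul_of_nonneg_left hSumD hθ
  -- ROW (ii)
  have row₂ : ∑ q : Plaq P k, (6 * t q ^ 2 + 4 * t q ^ 3 + t q ^ 4) * dist1 (GaugeField.plaqHol V q) ≤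
      θ * (176 * P.d * (τ * M₁)) := by
    calc ∑ q : Plaq P k, (6 * t q ^ 2 + 4 * t q ^ 3 + t q ^ 4) * dist1 (GaugeField.plaqHol V q)
        ≤ ∑ q : Plaq P k, (6 * t q ^ 2 + 4 * t q ^ 3 + t q ^ 4) * θ :=
          Finset.sum_le_sum fun q _ => mul_le_mul_of_nonneg_left (hV q).le (hr0 q)
      _ = θ * ∑ q : Plaq P k, (6 * t q ^ 2 + 4 * t q ^ 3 + t q ^ 4) := by rw [← Finset.sum_mul, mul_comm]
      _ ≤ θ * (176 * P.d * (τ * M₁)) := mul_le_mul_of_nonneg_left hSumr hθ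
  -- ROW (iii)
  have hSumD2 : ∑ q : Plaq P k, D q ^ 2 ≤ (8 * τ ^ 2 + 2 * τ * (4 * η + θ)) * (2 * P.d * M₁ * (4 * τ + 4 * η + θ)) := by
    calc ∑ q : Plaq P k, D q ^ 2 ≤ ∑ q : Plaq P k, (8 * τ ^ 2 + 2 * τ * (4 * η + θ)) * D q :=
          Finset.sum_le_sum fun q _ => by rw [sq]; exact mul_le_mul_of_nonneg_right (hDq q).2 (hDq q).1
      _ = (8 * τ ^ 2 + 2 * τ * (4 * η + θ)) * ∑ q : Plaq P k, D q := (Finset.mul_sum _ _ _).symm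
      _ ≤ (8 * τ ^ 2 + 2 * τ * (4 * η + θ)) * (2 * P.d * M₁ * (4 * τ + 4 * η + θ)) :=
          mul_le_mul_of_nonneg_left hSumD (by positivity)
  have h3 := Finset.sum_le_sum fun q (_ : q ∈ (Finset.univ : Finset (Plaq P k))) =>
    abs_sq_add_three_le (s q) (D q) (6 * t q ^ 2 + 4 * t q ^ 3 + t q ^ 4)
  rw [← Finset.mul_sum, Finset.sum_add_distrib, Finset.sum_add_distrib] at h3
  -- assemble
  have e2 : θ * (176 * ↑P.d * (τ * M₁)) + θ * (2 * ↑P.d * M₁ * (4 * τ + 4 * η + θ)) =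
      θ * ↑P.d * M₁ * (2 * (4 * τ + 4 * η + θ) + 176 * τ) := by ring
  have e3 : 3 / 2 * ((8 * τ ^ 2 + 2 * τ * (4 * η + θ)) * (2 * ↑P.d * M₁ * (4 * τ + 4 * η + θ)) +
      1936 * τ ^ 2 * (4 * (4 * ↑P.d * (τ * M₁)))) =
      3 / 2 * ↑P.d * M₁ * ((8 * τ ^ 2 + 2 * τ * (4 * η + θ)) * (2 * (4 * τ + 4 * η + θ)) + 30976 * τ ^ 3) := by ring
  linarith [row₁, row₂, h3, hSumD2, hSumr2]

/-! ## §4 Composition with the action lower bound -/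

/-- ★★★ **SIGNAL MINUS CLOSED-FORM COST ≤ ACTION DROP (framed left product).**  ✓`comb_pairing_sub_le_wilsonAction4_sub_mulField_local`
composed with §3: for `E_b = expPoint(c_b • Ad_{(axialT V c₀ b.src)⁻¹} n̂₀)`, `|c_b| ≤ τ ≤ 1∕4`, `Σ_b|c_b| ≤ M₁`, supports in the `r`-ball,
`2(r+2) ≤` period, `PlaqSmall θ V`, `η := ((2d(r+1)+2)²∕4)·θ`:
`Σ_q (−s_q)·⟨n̂₀, imVec su2Quat W̃(∂q)⟩ − [(3∕2)Σ_q s_q² + θ·d·M₁·(2(4τ+4η+θ) + 176τ) + (3∕2)·d·M₁·((8τ²+2τ(4η+θ))·2(4τ+4η+θ) + 30976τ³)]`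
`  ≤ A(V) − A(E·V)`. [cite: Balaban1985Averaging, (10) p.19, (19)-(20) p.21, p.24; Balaban1987RG1, (0.2) p.252] -/
theorem comb_signal_sub_cost_le_wilsonAction4_sub_mulField {θ : ℝ} (hθ : 0 ≤ θ) {V : GaugeField P k SU2} (hV : PlaqSmall θ V)
    (c₀ : Site P k) {r : ℕ} (hr : 2 * (r + 2) ≤ P.sitesPerDir k) {n : EuclideanSpace ℝ (Fin 3)} (hn : ‖n‖ = 1)
    (E : GaugeField P k SU2) (c : PBond P k → ℝ) (hE : ∀ b, E b = expPoint (c b • adSU2 (axialT V c₀ b.src)⁻¹ n))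
    (hcf : ∀ b, c b ≠ 0 → ∃ z : Fin P.d → ℤ, (∀ ν, (z ν).natAbs ≤ r) ∧ b.src = transl c₀ z)
    {τ M₁ : ℝ} (hcτ : ∀ b, |c b| ≤ τ) (hτ0 : 0 ≤ τ) (hτ : τ ≤ 1 / 4) (hM : ∑ b : PBond P k, |c b| ≤ M₁)
    (s : Plaq P k → ℝ) (hs : ∀ q, s q = c (bond₁ q) + c (bond₂ q) - c (bond₃ q) - c (bond₄ q)) :
    (∑ q : Plaq P k, -s q * ⟪n, imVec (su2Quat (GaugeField.plaqHol (GaugeField.gaugeAct (axialT V c₀) V) q))⟫) -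
        (3 / 2 * ∑ q : Plaq P k, s q ^ 2 +
          θ * P.d * M₁ * (2 * (4 * τ + 4 * ((((2 * P.d * (r + 1) + 2 : ℕ) : ℝ) ^ 2 / 4) * θ) + θ) + 176 * τ) +
          3 / 2 * P.d * M₁ * ((8 * τ ^ 2 + 2 * τ * (4 * ((((2 * P.d * (r + 1) + 2 : ℕ) : ℝ) ^ 2 / 4) * θ) + θ)) *
            (2 * (4 * τ + 4 * ((((2 * P.d * (r + 1) + 2 : ℕ) : ℝ) ^ 2 / 4) * θ) + θ)) + 30976 * τ ^ 3)) ≤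
      wilsonAction4 V - wilsonAction4 (mulField E V) := by
  set η : ℝ := (((2 * P.d * (r + 1) + 2 : ℕ) : ℝ) ^ 2 / 4) * θ with hη
  have hη0 : 0 ≤ η := by rw [hη]; positivity
  have h1 : ∀ b, |c b| ≤ 1 := fun b => (hcτ b).trans (by linarith)
  -- the rows' symbols
  set D : Plaq P k → ℝ := fun q => 2 * (c (bond₁ q) ^ 2 + c (bond₂ q) ^ 2 + c (bond₃ q) ^ 2 + c (bond₄ q) ^ 2) +
    2 * (|c (bond₂ q)| * η + |c (bond₃ q)| * (3 * η) + |c (bond₄ q)| * θ) with hDdef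
  set t : Plaq P k → ℝ := fun q => |c (bond₁ q)| + |c (bond₂ q)| + |c (bond₃ q)| + |c (bond₄ q)| with htdef
  have hloc := comb_pairing_sub_le_wilsonAction4_sub_mulField_local hθ hV c₀ hr hn E c hE hcf h1 t
    (fun q => by simp only [htdef]; linarith [abs_nonneg (c (bond₂ q)), abs_nonneg (c (bond₃ q)), abs_nonneg (c (bond₄ q))])
    (fun q => by simp only [htdef]; linarith [abs_nonneg (c (bond₁ q)), abs_nonneg (c (bond₃ q)), abs_nonneg (c (bond₄ q))])
    (fun q => by simp only [htdef]; linarith [abs_nonneg (c (bond₁ q)), abs_nonneg (c (bond₂ q)), abs_nonneg (c (bond₄ q))])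
    (fun q => by simp only [htdef]; linarith [abs_nonneg (c (bond₁ q)), abs_nonneg (c (bond₂ q)), abs_nonneg (c (bond₃ q))])
    s D hs (fun q => by simp only [hDdef, hη])
  have hrest := rest_le hθ hV hη0 c hcτ hτ0 hτ hM s D t (fun q => by simp only [hDdef]) (fun q => by simp only [htdef])
  rw [Finset.sum_sub_distrib] at hloc
  linarith

/-- ★★★ **THE SAME FOR THE SWEEP PAIR OF ✓`exists_sweep_pair_comb`** (the door's `Ψ′`): amplitude `cb` on `S` with `|cb_b| ≤ τ ≤ 1∕4`
and `Σ_{b ∈ S} |cb_b| ≤ M₁`; the signed amplitude is `c_b = −cb_b` on `S`, `0` off `S`, and `s_q` is passed with its defining equation: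
`Σ_q (−s_q)·⟨n̂₀, imVec su2Quat W̃(∂q)⟩ − ⟨closed-form cost⟩ ≤ A(V) − A(Ψ′V)`.  The door's `hGLUE` takes `REST :=` the bracket.
[cite: Balaban1985Averaging, (10) p.19, (19)-(20) p.21, p.24; Balaban1987RG1, (0.2) p.252] -/
theorem comb_signal_sub_cost_le_wilsonAction4_sub_sweepInv [DecidableEq (PBond P k)] {θ : ℝ} (hθ : 0 ≤ θ)
    {V : GaugeField P k SU2} (hV : PlaqSmall θ V) (c₀ : Site P k) {r : ℕ} (hr : 2 * (r + 2) ≤ P.sitesPerDir k)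
    {n : EuclideanSpace ℝ (Fin 3)} (hn : ‖n‖ = 1)
    (S : Finset (PBond P k)) (hS : ∀ b ∈ S, ∃ z : Fin P.d → ℤ, (∀ ν, (z ν).natAbs ≤ r) ∧ b.src = transl c₀ z)
    (cb : PBond P k → ℝ) (nf : PBond P k → GaugeField P k SU2 → SU2)
    (hnf : ∀ b U, nf b U = expPoint (cb b • adSU2 (axialT U c₀ b.src)⁻¹ n))
    (Ψ' : GaugeField P k SU2 → GaugeField P k SU2) (hΨ' : ∀ U b, Ψ' U b = if b ∈ S then (nf b U)⁻¹ * U b else U b)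
    {τ M₁ : ℝ} (hcτ : ∀ b ∈ S, |cb b| ≤ τ) (hτ0 : 0 ≤ τ) (hτ : τ ≤ 1 / 4) (hM : ∑ b ∈ S, |cb b| ≤ M₁)
    (s : Plaq P k → ℝ)
    (hs : ∀ q, s q = (if bond₁ q ∈ S then -cb (bond₁ q) else 0) + (if bond₂ q ∈ S then -cb (bond₂ q) else 0) -
        (if bond₃ q ∈ S then -cb (bond₃ q) else 0) - (if bond₄ q ∈ S then -cb (bond₄ q) else 0)) :
    (∑ q : Plaq P k, -s q * ⟪n, imVec (su2Quat (GaugeField.plaqHol (GaugeField.gaugeAct (axialT V c₀) V) q))⟫) -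
        (3 / 2 * ∑ q : Plaq P k, s q ^ 2 +
          θ * P.d * M₁ * (2 * (4 * τ + 4 * ((((2 * P.d * (r + 1) + 2 : ℕ) : ℝ) ^ 2 / 4) * θ) + θ) + 176 * τ) +
          3 / 2 * P.d * M₁ * ((8 * τ ^ 2 + 2 * τ * (4 * ((((2 * P.d * (r + 1) + 2 : ℕ) : ℝ) ^ 2 / 4) * θ) + θ)) *
            (2 * (4 * τ + 4 * ((((2 * P.d * (r + 1) + 2 : ℕ) : ℝ) ^ 2 / 4) * θ) + θ)) + 30976 * τ ^ 3)) ≤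
      wilsonAction4 V - wilsonAction4 (Ψ' V) := by
  rw [CovariantDischargeCombSweepLinCobd.sweepInv_eq_mulField S nf Ψ' hΨ' V]
  have hE : ∀ b, (fun b => if b ∈ S then (nf b V)⁻¹ else (1 : SU2)) b =
      expPoint ((fun b => if b ∈ S then -cb b else 0) b • adSU2 (axialT V c₀ b.src)⁻¹ n) := fun b =>
    CovariantDischargeCombSweepLinCobd.combFactor_eq_expPoint c₀ n cb S nf hnf V b
  have hcf : ∀ b, (fun b => if b ∈ S then -cb b else 0) b ≠ 0 →
      ∃ z : Fin P.d → ℤ, (∀ ν, (z ν).natAbs ≤ r) ∧ b.src = transl c₀ z := by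
    intro b hb
    by_cases h : b ∈ S
    · exact hS b h
    · exact absurd (by simp [h]) hb
  have hcτ' : ∀ b, |(fun b => if b ∈ S then -cb b else 0) b| ≤ τ := by
    intro b
    by_cases h : b ∈ S
    · simp only [h, if_true, abs_neg]; exact hcτ b h
    · simp only [h, if_false, abs_zero]; exact hτ0
  have hM' : ∑ b : PBond P k, |(fun b => if b ∈ S then -cb b else 0) b| ≤ M₁ := by
    have e : ∑ b : PBond P k, |(fun b => if b ∈ S then -cb b else 0) b| = ∑ b ∈ S, |cb b| := by
      rw [← Finset.sum_subset (Finset.subset_univ S) (fun b _ hb => by simp [hb])]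
      exact Finset.sum_congr rfl fun b hb => by simp [hb]
    rw [e]; exact hM
  exact comb_signal_sub_cost_le_wilsonAction4_sub_mulField hθ hV c₀ hr hn _ _ hE hcf hcτ' hτ0 hτ hM' s hs

end Summit.QuantumFields.YangMills.Theorems.CovariantDischargeCombSweepCostRows

end
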